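import Literature.AnabelianGeometry.EtaleTheta.Discharge.Sec5CyclotomicRigidityCodOfBiKummerDataLaws

/-!
# [EtTh] Prop. 5.5: the fixed-source transport step FROM the print-faithful one (PDF p.102 = printed p.328; Prop. 4.2 (iv) p.315 (PDF p.89))

Mochizuki, *The étale theta function and its Frobenioid-theoretic manifestations*, Publ. RIMS **45** (2009)
[cite: MochizukiEtTh2009, Prop 5.5 proof p.328 (PDF p.102)].  abc-iut cell, layer L2, K4 line (plan/L2/SUBDAG-EtTh-Thm56.md row
P55-L05; seat abc-iut-w5-d020 gen 3).  PROOF-ONLY (no definitions, no new named fact).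

abc-iut-L2-t4's transport step `LinearlyReachableFromBN 𝔉` (every theta-saturated `S` receives a linear arrow FROM `B_N` with `Δ`-push
onto and `μ`-pull injective) carries the flag «stronger than print» (abc-iut-L2-lead ruling F-w5d123-3): print (p.328 l.2–8) reaches
`S` from SOME `l·N`-codomain `S″` — abc-iut-w5-d123's `ReachableFromCodomains 𝔉 IsCod`.  This file retires the flag as a HYPOTHESIS
GAP: since the admissible codomains are pairwise ISOMORPHIC (Prop. 4.2 (iv), p.315 (PDF p.89): «an isomorphism between the two given
`N`-th roots … `ζ_B`») and `B_N` is one of them, a reach `S″ → S` precomposed with `ζ : B_N ⥲ S″` is a reach from `B_N` (isomorphisms are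
linear; along them `Δ`-push and `μ`-pull are bijective by the laws P55-L06b — abc-iut-w5-d020's `lDeltaModNMap_iso_surjective` /
`muTorsionPull_iso_injective`, p427514).  So `LinearlyReachableFromBN` ⟸ {`ReachableFromCodomains`, `B_N ≅ S″` for every codomain,
`UnitsPullComp/Id`, `LDeltaMapComp/Id`} — abstractly (`linearlyReachableFromBN_of_reachableFromCodomains`) and at abc-iut-L2-t4's
assembled data over the root-indexed class (`linearlyReachableFromBN_ofBiKummerData_of_codomains`, `UnitsPullComp/Id` discharged),
where it feeds every fixed-source theorem of the line (p420099, p420788, p421202, p425506, p427247, p427275, p428546) BY NAME.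
HONEST FRAMING: kernel-checked implications between typed statements; nothing of [EtTh] is asserted unconditionally; nothing
asserts that such data exist for an actual curve; typed ≠ discharged; no side taken on [IUTchIII] Cor. 3.12.
-/

noncomputable section

namespace Literature.AnabelianGeometry.EtaleTheta

open CategoryTheory Opposite FrobenioidCyclotomicRigidity Literature.AlgebraicGeometry.Frobenioids

universe u₀ v₀ u v w w₁ v₁ v₁' u₁ u₁'

namespace ThetaFrobenioid

namespace Thm56Sub

variable {C : Type u₁} [Category.{v₁} C] {D : Type u₁'} [Category.{v₁'} D] {𝔉 : ThetaFrobenioid.{w₁} C D}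
  {IsCod : C → Prop}

/-- **abc-iut-L2-t4's `LinearlyReachableFromBN` FROM print's reachability** (p.328 l.2–8 + Prop. 4.2 (iv)): if every theta-saturated
`S` is reached from SOME admissible codomain (abc-iut-w5-d123's `ReachableFromCodomains`) and `B_N` is isomorphic to every admissible
codomain, then every theta-saturated `S` is reached from `B_N` itself — precompose the reach with the isomorphism (linear; `Δ`-push
onto and `μ`-pull injective along it by the laws P55-L06b).  [cite: MochizukiEtTh2009, Prop 5.5 proof p.328 (PDF p.102)] -/
theorem linearlyReachableFromBN_of_reachableFromCodomains (hUc : UnitsPullComp 𝔉) (hUi : UnitsPullId 𝔉)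
    (hLc : LDeltaMapComp 𝔉) (hLi : LDeltaMapId 𝔉) (hreach : ReachableFromCodomains 𝔉 IsCod)
    (hisoB : ∀ S'' : C, IsCod S'' → Nonempty (𝔉.BN ≅ S'')) : LinearlyReachableFromBN 𝔉 := by
  intro S hS
  obtain ⟨S'', hc, φ, hlin, hsurj, hinj⟩ := hreach S hS
  obtain ⟨ζ⟩ := hisoB S'' hc
  refine ⟨ζ.hom ≫ φ, isLinear_comp (𝔉.isLinear_iso_hom ζ) hlin, ?_, ?_⟩
  · intro y
    obtain ⟨x, rfl⟩ := hsurj y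
    obtain ⟨z, rfl⟩ := lDeltaModNMap_iso_surjective hLc hLi ζ x
    exact ⟨z, lDeltaModNMap_comp hLc _ _ z⟩
  · intro u u' huu'
    rw [muTorsionPull_comp hUc, muTorsionPull_comp hUc] at huu'
    exact hinj (muTorsionPull_iso_injective hUc hUi ζ huu')

/-- Conversely (abc-iut-w5-d123's `reachableFromCodomains_of_linearlyReachableFromBN`, recorded for the equivalence): under «`B_N` is an
admissible codomain isomorphic to all others» the two transport steps are EQUIVALENT.
[cite: MochizukiEtTh2009, Prop 5.5 proof p.328 (PDF p.102)] -/
theorem linearlyReachableFromBN_iff_reachableFromCodomains (hUc : UnitsPullComp 𝔉) (hUi : UnitsPullId 𝔉)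
    (hLc : LDeltaMapComp 𝔉) (hLi : LDeltaMapId 𝔉) (hBcod : IsCod 𝔉.BN)
    (hisoB : ∀ S'' : C, IsCod S'' → Nonempty (𝔉.BN ≅ S'')) :
    LinearlyReachableFromBN 𝔉 ↔ ReachableFromCodomains 𝔉 IsCod :=
  ⟨reachableFromCodomains_of_linearlyReachableFromBN 𝔉 hBcod,
    fun h => linearlyReachableFromBN_of_reachableFromCodomains hUc hUi hLc hLi h hisoB⟩

end Thm56Sub

/-! ### At the genuine §5 data, root-indexed codomains -/

section Data

variable {K : Type u₀} [Field K]
  {X : SemiGraphs.TemperedArithmeticGroup.{u₀} K} {D₀ : Type u₀} [Category.{v₀} D₀]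
  {V : FrdIMonoidStub.{w}} {T₀ : RealifiedDivisorMonoids (D₀ := D₀) V} {D : Type u} [Category.{v} D]
  {VD : FrdICatStub.{u, v, w} D} {S : BiKummerSetting X T₀ D VD}
  {pullFrac : ∀ {A A' : S.C} (_ : A' ⟶ A), S.biratUnits A → S.biratUnits A'}
  {lv N : ℕ+} {T : ThetaEnvData.{max v w} N} {θ : S.biratUnits S.Aodot} {Bl : S.C}
  {Pl : S.FractionPair θ Bl} {Rl : S.NthRoot θ Pl lv pullFrac}
  (h : ModelFrobenioid.Hypotheses S.tf.divisorMonoid S.tf.ratFnFunctor)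
  (toB : ∀ A : S.C, S.biratUnits A →* S.tf.biratUnitsModel A) (Q : FrobenioidTheta.ThetaSubquotientStub.{w} D)
  (odd_l : Odd (lv : ℕ)) (R : S.NthRoot Rl.root Rl.pair N pullFrac) (ιX : T.PiX ≃ₜ* X.Pi)
  (hopen : IsOpen ((S.galoisSurj R.AN.base R.αData.isGalois).ker : Set X.Pi)) (σ : Aut R.AN.base →* Aut R.AN)
  (K' : Type w) [Field K'] (constEmb : K'ˣ →* S.tf.biratUnitsModel R.BN)
  (constEmb_injective : Function.Injective constEmb)
  (hdivc : ∀ g : Aut R.BN.base,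
    ModelFrobenioid.div ((σ ((BiKummerSetting.NthRoot.baseIso S R).conjAut.symm g)).hom ≫ R.pair.num) =
      ModelFrobenioid.div R.pair.num)
  (hdivp : ∀ y : T.PiYdd,
    ModelFrobenioid.div ((σ (S.galoisSurj R.AN.base R.αData.isGalois (ιX y.1))).hom ≫ R.pair.den) =
      ModelFrobenioid.div R.pair.den)
  {ι : Type*} (Rι : ι → S.NthRoot Rl.root Rl.pair N pullFrac)

/-- **`LinearlyReachableFromBN` for the assembled §5 data FROM print's reachability over the root codomains** (p.328 l.2–8 + Prop. 4.2
(iv) «`ζ_B : B_N ⥲ B̄_N`» for the `N`-th roots `R` and `Rι i` of the same fraction-pair): the transport laws `UnitsPullComp/Id` are theorems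
at the model (`ModelFrobenioid.unitsPull_comp/_id`, abc-iut-w5-d020 p418890), `LDeltaMapComp/Id` are the laws of the free stub `Q`.  Feeds the binder `hreach` of every fixed-source theorem of
the line (`cyclotomicRigidity_ofBiKummerData*`, `cyclotomicRigidityPreserved_ofBiKummerData`, `…_of_leaves`) BY NAME.
[cite: MochizukiEtTh2009, Prop 5.5 proof p.328 (PDF p.102)] -/
theorem linearlyReachableFromBN_ofBiKummerData_of_codomains
    (hLc : Thm56Sub.LDeltaMapComp (ofBiKummerData h toB Q odd_l R ιX hopen σ K' constEmb constEmb_injective hdivc hdivp))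
    (hLi : Thm56Sub.LDeltaMapId (ofBiKummerData h toB Q odd_l R ιX hopen σ K' constEmb constEmb_injective hdivc hdivp))
    (hreach : ReachableFromCodomains (ofBiKummerData h toB Q odd_l R ιX hopen σ K' constEmb constEmb_injective hdivc hdivp)
      (fun S'' => ∃ i, (Rι i).BN = S''))
    (hisoB : ∀ i : ι, Nonempty (R.BN ≅ (Rι i).BN)) :
    LinearlyReachableFromBN (ofBiKummerData h toB Q odd_l R ιX hopen σ K' constEmb constEmb_injective hdivc hdivp) := by
  refine Thm56Sub.linearlyReachableFromBN_of_reachableFromCodomains (fun φ ψ => ModelFrobenioid.unitsPull_comp φ ψ)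
    (fun S' => ModelFrobenioid.unitsPull_id S') hLc hLi hreach ?_
  rintro S'' ⟨i, rfl⟩
  exact hisoB i

end Data

end ThetaFrobenioid

end Literature.AnabelianGeometry.EtaleTheta

end
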